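import Summits.Ventures.LatticeQCDFlow.Exactness.IMHAnyStartMSE
import Summits.Ventures.LatticeQCDFlow.Exactness.IMHWarmStartSandwich
import HarnessLib

/-!
# Warm and hot starts, second order — MULTIPLICATIVELY: `μ₀ ≤ M·π ⇒ MSE_{μ₀}(N; b) ≤ (1 + (M − 1)·r^b)·MSE_π(N)`, and a
# hot-started flow-MCMC run (`w ≥ w_min`) has `MSE_q(N; b) ≤ (1 + (1/w_min − 1)·r^b)·MSE_π(N)`: no discards are needed for
# relative accuracy, `N ≥ (2W − 1)·Var_π f/(w_min·ε²)` kept updates give `MSE ≤ ε²` from the hot start at `b = 0`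

HONEST FRAMING: exact (Metropolis-corrected) sampling algorithms for lattice gauge theory;
figures of merit are autocorrelation/cost numbers at stated couplings and volumes; no
continuum-physics claim.

Venture `LatticeQCDFlow` (cell pub-lqcd), topic `Exactness`; FANOUT row 30 (lean-1, GEN-35).  NEW WORK of the
cell, general state space.  `K = indepMH q w` (normalised weight `w` maximal at `x₀`, `W = w(x₀)`, `r = 1 − 1/W`),
`A_{N,b}` the window average of a bounded measurable `f`, `MSE_{μ₀}(N; b) = E_{μ₀}[(A_{N,b} − π f)²]`, `V = Var_π f`.
This generation's `Exactness/IMHAnyStartMSE` priced every start ADDITIVELY (`+ r^b·D²`, the range); GEN-34's warm-start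
sandwich (`Exactness/IMHWarmStartSandwich`: `μ₀ ≤ M·π ⇒ E_{μ₀}[F(X_{b+·})] ≤ (1 + (M − 1)r^b)·E_π[F]` for nonnegative
bounded statistics, and the mirror for `m·π ≤ μ₀`) prices warm starts MULTIPLICATIVELY — applied to the squared error:

* §1 **`imh_chain_windowMSE_warmStart_le`** — `μ₀ ≤ M·π` (`M ≥ 1`) ⇒ `MSE_{μ₀}(N; b) ≤ (1 + (M − 1)·r^b)·MSE_π(N)`, hence
  (**`…_le_explicit`**) `≤ (1 + (M − 1)·r^b)·(2W − 1)·V/N`: RELATIVE accuracy — the start costs a FACTOR that decays like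
  `r^b`, not an additive `D²`; **`imh_chain_windowMSE_warmStart_ge`** — `m·π ≤ μ₀` (`0 ≤ m`) ⇒
  `MSE_{μ₀}(N; b) ≥ (1 − (1 − m)·r^b)·MSE_π(N)`.
* §2 **`wmin_le_one`** — a uniform floor `0 < w_min ≤ w` of a normalised weight has `w_min ≤ 1`;
  **`imh_chain_windowMSE_hotStart_le_mul`** — THE HOT START (`μ₀ = q ≤ (1/w_min)·π`):
  `MSE_q(N; b) ≤ (1 + (1/w_min − 1)·r^b)·MSE_π(N) ≤ (1/w_min)·MSE_π(N)` for EVERY `b`, and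
  (**`…_le_explicit`**) `≤ (1 + (1/w_min − 1)·r^b)·(2W − 1)·V/N`.
* §3 **`imh_chain_windowMSE_hotStart_le_of_sampleSize`** — NO DISCARDS NEEDED FOR RELATIVE ACCURACY FROM THE HOT
  START: `(2W − 1)·V ≤ w_min·ε²·N ⇒ MSE_q(N; b) ≤ ε²` for every `b ≥ 0` (in particular `b = 0`): a hot-started run pays
  for its start with the factor `1/w_min` in kept updates instead of a burn-in.

Reading (gauge files `Scaling/AutoregressiveGauge…HotStartMSEMultiplicative`): the autoregressive proposal of an exact
gauge sampler has density `ρ ≤ ρ_max` w.r.t. the Wilson target (the kernel weight `ρ⁻¹` is floored, `Scaling/…HotStartChiSq`),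
so a hot-started run has mean-square error at most `(1 + (ρ_max − 1)(1 − A)^b)` times the equilibrium run's.
NOT CLAIMED: that the multiplicative law beats the additive one for a particular `N` (it does once
`MSE_π(N)·(1/w_min − 1) ≤ r·D²`); any value of `w_min`; warm starts that are not dominated by a multiple of `π` (a Dirac
start has no such bound — the additive laws are then the statement).  No `sorry`, no new definitions, nothing cited.
-/

noncomputable section

namespace Summit.Ventures.LatticeQCDFlow.Exactness

open MeasureTheory ProbabilityTheory Function Finset
open scoped ENNReal
open Summit.Ventures.LatticeQCDFlow.Scoring

variable {Ω : Type*} [MeasurableSpace Ω] {q : Measure Ω} [IsProbabilityMeasure q] {w : Ω → ℝ}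

/-! ## §1 Warm starts: the error is sandwiched multiplicatively -/

/-- **`μ₀ ≤ M·π ⇒ MSE_{μ₀}(N; b) ≤ (1 + (M − 1)·r^b)·MSE_π(N)`** (`M ≥ 1`, `a ≤ f ≤ c` measurable, `N ≥ 1`). [ours] -/
theorem imh_chain_windowMSE_warmStart_le [Fact (Measurable w)] (hw0 : ∀ y, 0 < w y) {x₀ : Ω}
    (hmax : ∀ y, w y ≤ w x₀) [IsProbabilityMeasure (q.withDensity fun y => ENNReal.ofReal (w y))]
    (μ₀ : Measure Ω) [IsProbabilityMeasure μ₀] {M : ℝ} (hM1 : 1 ≤ M)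
    (hup : μ₀ ≤ ENNReal.ofReal M • (q.withDensity fun y => ENNReal.ofReal (w y)))
    {f : Ω → ℝ} (hf : Measurable f) {a c : ℝ} (ha : ∀ x, a ≤ f x) (hc : ∀ x, f x ≤ c) (b : ℕ) {N : ℕ} (hN : N ≠ 0) :
    ∫ x, ((∑ i ∈ range N, f (x (b + i))) / N - ∫ z, f z ∂(q.withDensity fun y => ENNReal.ofReal (w y))) ^ 2
        ∂(Kernel.trajMeasure (X := fun _ : ℕ => Ω) μ₀
          (fun n : ℕ => (indepMH q w).comap (fun h : (i : ↥(Finset.Iic n)) → Ω => h ⟨n, Finset.mem_Iic.2 le_rfl⟩)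
            (measurable_pi_apply _))) ≤
      (1 + (M - 1) * (1 - (w x₀)⁻¹) ^ b) *
        ∫ x, ((∑ i ∈ range N, f (x i)) / N - ∫ z, f z ∂(q.withDensity fun y => ENNReal.ofReal (w y))) ^ 2
          ∂(Kernel.trajMeasure (X := fun _ : ℕ => Ω) (q.withDensity fun y => ENNReal.ofReal (w y))
            (fun n : ℕ => (indepMH q w).comap (fun h : (i : ↥(Finset.Iic n)) → Ω => h ⟨n, Finset.mem_Iic.2 le_rfl⟩)
              (measurable_pi_apply _))) := by
  set m := ∫ z, f z ∂(q.withDensity fun y => ENNReal.ofReal (w y)) with hm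
  have h := imh_chain_shift_integral_le_of_le (q := q) hw0 hmax μ₀ hM1 hup
    (F := fun x : ℕ → Ω => ((∑ i ∈ range N, f (x i)) / N - m) ^ 2) (measurable_sq_timeAverage_sub hf m N)
    (C := (max (m - a) (c - m)) ^ 2) (fun x => sq_nonneg _)
    (fun x => by simpa using sq_timeAverage_sub_le ha hc m hN x 0) b (x₀ := x₀)
  simpa using h

/-- **Explicitly**: `μ₀ ≤ M·π ⇒ MSE_{μ₀}(N; b) ≤ (1 + (M − 1)·r^b)·(2W − 1)·Var_π f/N`. [ours] -/
theorem imh_chain_windowMSE_warmStart_le_explicit [Fact (Measurable w)] (hw0 : ∀ y, 0 < w y) {x₀ : Ω}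
    (hmax : ∀ y, w y ≤ w x₀) [IsProbabilityMeasure (q.withDensity fun y => ENNReal.ofReal (w y))]
    (μ₀ : Measure Ω) [IsProbabilityMeasure μ₀] {M : ℝ} (hM1 : 1 ≤ M)
    (hup : μ₀ ≤ ENNReal.ofReal M • (q.withDensity fun y => ENNReal.ofReal (w y)))
    {f : Ω → ℝ} (hf : Measurable f) {a c : ℝ} (ha : ∀ x, a ≤ f x) (hc : ∀ x, f x ≤ c) (b : ℕ) {N : ℕ} (hN : N ≠ 0) :
    ∫ x, ((∑ i ∈ range N, f (x (b + i))) / N - ∫ z, f z ∂(q.withDensity fun y => ENNReal.ofReal (w y))) ^ 2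
        ∂(Kernel.trajMeasure (X := fun _ : ℕ => Ω) μ₀
          (fun n : ℕ => (indepMH q w).comap (fun h : (i : ↥(Finset.Iic n)) → Ω => h ⟨n, Finset.mem_Iic.2 le_rfl⟩)
            (measurable_pi_apply _))) ≤
      (1 + (M - 1) * (1 - (w x₀)⁻¹) ^ b) * ((2 * w x₀ - 1) *
        (∫ x, (f x - ∫ z, f z ∂(q.withDensity fun y => ENNReal.ofReal (w y))) ^ 2
          ∂(q.withDensity fun y => ENNReal.ofReal (w y))) / N) := by
  have h1 := imh_chain_windowMSE_warmStart_le (q := q) hw0 hmax μ₀ hM1 hup hf ha hc b hN (x₀ := x₀)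
  have hC : ∀ x, |f x| ≤ max |a| |c| := fun x => abs_le_max_abs_abs (ha x) (hc x)
  have h2 := imh_chain_mse_stationary_le (q := q) hw0 hmax hf hC hN (x₀ := x₀)
  have hW : 1 ≤ w x₀ := one_le_of_mode (q := q) hmax
  have hr : 0 ≤ (1 - (w x₀)⁻¹) ^ b := pow_nonneg (sub_nonneg.2 (inv_le_one_of_one_le₀ hW)) b
  have hfac : 0 ≤ 1 + (M - 1) * (1 - (w x₀)⁻¹) ^ b := by nlinarith
  exact h1.trans (mul_le_mul_of_nonneg_left h2 hfac)

/-- **`m·π ≤ μ₀ ⇒ MSE_{μ₀}(N; b) ≥ (1 − (1 − m)·r^b)·MSE_π(N)`** (`0 ≤ m`). [ours] -/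
theorem imh_chain_windowMSE_warmStart_ge [Fact (Measurable w)] (hw0 : ∀ y, 0 < w y) {x₀ : Ω}
    (hmax : ∀ y, w y ≤ w x₀) [IsProbabilityMeasure (q.withDensity fun y => ENNReal.ofReal (w y))]
    (μ₀ : Measure Ω) [IsProbabilityMeasure μ₀] {m : ℝ} (hm0 : 0 ≤ m)
    (hlow : ENNReal.ofReal m • (q.withDensity fun y => ENNReal.ofReal (w y)) ≤ μ₀)
    {f : Ω → ℝ} (hf : Measurable f) {a c : ℝ} (ha : ∀ x, a ≤ f x) (hc : ∀ x, f x ≤ c) (b : ℕ) {N : ℕ} (hN : N ≠ 0) :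
    (1 - (1 - m) * (1 - (w x₀)⁻¹) ^ b) *
        ∫ x, ((∑ i ∈ range N, f (x i)) / N - ∫ z, f z ∂(q.withDensity fun y => ENNReal.ofReal (w y))) ^ 2
          ∂(Kernel.trajMeasure (X := fun _ : ℕ => Ω) (q.withDensity fun y => ENNReal.ofReal (w y))
            (fun n : ℕ => (indepMH q w).comap (fun h : (i : ↥(Finset.Iic n)) → Ω => h ⟨n, Finset.mem_Iic.2 le_rfl⟩)
              (measurable_pi_apply _))) ≤
      ∫ x, ((∑ i ∈ range N, f (x (b + i))) / N - ∫ z, f z ∂(q.withDensity fun y => ENNReal.ofReal (w y))) ^ 2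
        ∂(Kernel.trajMeasure (X := fun _ : ℕ => Ω) μ₀
          (fun n : ℕ => (indepMH q w).comap (fun h : (i : ↥(Finset.Iic n)) → Ω => h ⟨n, Finset.mem_Iic.2 le_rfl⟩)
            (measurable_pi_apply _))) := by
  set mf := ∫ z, f z ∂(q.withDensity fun y => ENNReal.ofReal (w y)) with hmf
  have h := imh_chain_shift_integral_ge_of_ge (q := q) hw0 hmax μ₀ hm0 hlow
    (F := fun x : ℕ → Ω => ((∑ i ∈ range N, f (x i)) / N - mf) ^ 2) (measurable_sq_timeAverage_sub hf mf N)
    (C := (max (mf - a) (c - mf)) ^ 2) (fun x => sq_nonneg _)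
    (fun x => by simpa using sq_timeAverage_sub_le ha hc mf hN x 0) b (x₀ := x₀)
  simpa using h

/-! ## §2 The hot start, multiplicatively -/

omit [MeasurableSpace Ω] in
/-- A uniform floor of a normalised weight is at most one: `0 < w_min ≤ w`, `∫ w dq = 1` ⇒ `w_min ≤ 1`. [ours,
bookkeeping] -/
theorem wmin_le_one [MeasurableSpace Ω] {q : Measure Ω} [IsProbabilityMeasure q] {w : Ω → ℝ} {wmin : ℝ}
    (hge : ∀ y, wmin ≤ w y) [IsProbabilityMeasure (q.withDensity fun y => ENNReal.ofReal (w y))] : wmin ≤ 1 := by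
  have h1 : (q.withDensity fun y => ENNReal.ofReal (w y)) Set.univ = 1 := measure_univ
  rw [withDensity_apply _ MeasurableSet.univ, Measure.restrict_univ] at h1
  have h2 : ∫⁻ _, ENNReal.ofReal wmin ∂q ≤ ∫⁻ y, ENNReal.ofReal (w y) ∂q :=
    lintegral_mono fun y => ENNReal.ofReal_le_ofReal (hge y)
  rw [h1, lintegral_const, measure_univ, mul_one, ENNReal.ofReal_le_one] at h2
  exact h2

/-- **THE HOT START, MULTIPLICATIVELY**: `0 < w_min ≤ w` ⇒ `MSE_q(N; b) ≤ (1 + (1/w_min − 1)·r^b)·MSE_π(N)` for every `b`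
(`a ≤ f ≤ c` measurable, `N ≥ 1`). [ours] -/
theorem imh_chain_windowMSE_hotStart_le_mul [Fact (Measurable w)] (hw0 : ∀ y, 0 < w y) {x₀ : Ω}
    (hmax : ∀ y, w y ≤ w x₀) {wmin : ℝ} (hwmin : 0 < wmin) (hge : ∀ y, wmin ≤ w y)
    [IsProbabilityMeasure (q.withDensity fun y => ENNReal.ofReal (w y))]
    {f : Ω → ℝ} (hf : Measurable f) {a c : ℝ} (ha : ∀ x, a ≤ f x) (hc : ∀ x, f x ≤ c) (b : ℕ) {N : ℕ} (hN : N ≠ 0) :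
    ∫ x, ((∑ i ∈ range N, f (x (b + i))) / N - ∫ z, f z ∂(q.withDensity fun y => ENNReal.ofReal (w y))) ^ 2
        ∂(Kernel.trajMeasure (X := fun _ : ℕ => Ω) q
          (fun n : ℕ => (indepMH q w).comap (fun h : (i : ↥(Finset.Iic n)) → Ω => h ⟨n, Finset.mem_Iic.2 le_rfl⟩)
            (measurable_pi_apply _))) ≤
      (1 + (wmin⁻¹ - 1) * (1 - (w x₀)⁻¹) ^ b) *
        ∫ x, ((∑ i ∈ range N, f (x i)) / N - ∫ z, f z ∂(q.withDensity fun y => ENNReal.ofReal (w y))) ^ 2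
          ∂(Kernel.trajMeasure (X := fun _ : ℕ => Ω) (q.withDensity fun y => ENNReal.ofReal (w y))
            (fun n : ℕ => (indepMH q w).comap (fun h : (i : ↥(Finset.Iic n)) → Ω => h ⟨n, Finset.mem_Iic.2 le_rfl⟩)
              (measurable_pi_apply _))) := by
  have hw : Measurable w := Fact.out
  have h1 : 1 ≤ wmin⁻¹ := one_le_inv_iff₀.2 ⟨hwmin, wmin_le_one (q := q) hge⟩
  exact imh_chain_windowMSE_warmStart_le (q := q) hw0 hmax q h1 (hotStart_le_target (q := q) hw hwmin hge) hf ha hc b hN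

/-- **Explicitly**: `MSE_q(N; b) ≤ (1 + (1/w_min − 1)·r^b)·(2W − 1)·Var_π f/N` from the hot start. [ours] -/
theorem imh_chain_windowMSE_hotStart_le_mul_explicit [Fact (Measurable w)] (hw0 : ∀ y, 0 < w y) {x₀ : Ω}
    (hmax : ∀ y, w y ≤ w x₀) {wmin : ℝ} (hwmin : 0 < wmin) (hge : ∀ y, wmin ≤ w y)
    [IsProbabilityMeasure (q.withDensity fun y => ENNReal.ofReal (w y))]
    {f : Ω → ℝ} (hf : Measurable f) {a c : ℝ} (ha : ∀ x, a ≤ f x) (hc : ∀ x, f x ≤ c) (b : ℕ) {N : ℕ} (hN : N ≠ 0) :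
    ∫ x, ((∑ i ∈ range N, f (x (b + i))) / N - ∫ z, f z ∂(q.withDensity fun y => ENNReal.ofReal (w y))) ^ 2
        ∂(Kernel.trajMeasure (X := fun _ : ℕ => Ω) q
          (fun n : ℕ => (indepMH q w).comap (fun h : (i : ↥(Finset.Iic n)) → Ω => h ⟨n, Finset.mem_Iic.2 le_rfl⟩)
            (measurable_pi_apply _))) ≤
      (1 + (wmin⁻¹ - 1) * (1 - (w x₀)⁻¹) ^ b) * ((2 * w x₀ - 1) *
        (∫ x, (f x - ∫ z, f z ∂(q.withDensity fun y => ENNReal.ofReal (w y))) ^ 2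
          ∂(q.withDensity fun y => ENNReal.ofReal (w y))) / N) := by
  have hw : Measurable w := Fact.out
  have h1 : 1 ≤ wmin⁻¹ := one_le_inv_iff₀.2 ⟨hwmin, wmin_le_one (q := q) hge⟩
  exact imh_chain_windowMSE_warmStart_le_explicit (q := q) hw0 hmax q h1 (hotStart_le_target (q := q) hw hwmin hge)
    hf ha hc b hN

/-! ## §3 No discards needed for relative accuracy from the hot start -/

/-- **`(2W − 1)·Var_π f ≤ w_min·ε²·N ⇒ MSE_q(N; b) ≤ ε²` for EVERY `b`** (hot start, `0 < w_min ≤ w`): a hot-started run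
reaches root-mean-square accuracy `ε` with `(2W − 1)·V/(w_min·ε²)` kept updates and NO burn-in. [ours] -/
theorem imh_chain_windowMSE_hotStart_le_of_sampleSize [Fact (Measurable w)] (hw0 : ∀ y, 0 < w y) {x₀ : Ω}
    (hmax : ∀ y, w y ≤ w x₀) {wmin : ℝ} (hwmin : 0 < wmin) (hge : ∀ y, wmin ≤ w y)
    [IsProbabilityMeasure (q.withDensity fun y => ENNReal.ofReal (w y))]
    {f : Ω → ℝ} (hf : Measurable f) {a c : ℝ} (ha : ∀ x, a ≤ f x) (hc : ∀ x, f x ≤ c) (b : ℕ) {N : ℕ} (hN : N ≠ 0)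
    {ε : ℝ} (hNε : (2 * w x₀ - 1) * ∫ x, (f x - ∫ z, f z ∂(q.withDensity fun y => ENNReal.ofReal (w y))) ^ 2
      ∂(q.withDensity fun y => ENNReal.ofReal (w y)) ≤ wmin * ε ^ 2 * N) :
    ∫ x, ((∑ i ∈ range N, f (x (b + i))) / N - ∫ z, f z ∂(q.withDensity fun y => ENNReal.ofReal (w y))) ^ 2
        ∂(Kernel.trajMeasure (X := fun _ : ℕ => Ω) q
          (fun n : ℕ => (indepMH q w).comap (fun h : (i : ↥(Finset.Iic n)) → Ω => h ⟨n, Finset.mem_Iic.2 le_rfl⟩)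
            (measurable_pi_apply _))) ≤ ε ^ 2 := by
  have h1 := imh_chain_windowMSE_hotStart_le_mul_explicit (q := q) hw0 hmax hwmin hge hf ha hc b hN (x₀ := x₀)
  set V := ∫ x, (f x - ∫ z, f z ∂(q.withDensity fun y => ENNReal.ofReal (w y))) ^ 2
    ∂(q.withDensity fun y => ENNReal.ofReal (w y)) with hV
  have hNpos : (0 : ℝ) < N := by exact_mod_cast Nat.pos_of_ne_zero hN
  have hW : 1 ≤ w x₀ := one_le_of_mode (q := q) hmax
  have hr0 : 0 ≤ (1 - (w x₀)⁻¹) ^ b := pow_nonneg (sub_nonneg.2 (inv_le_one_of_one_le₀ hW)) b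
  have hr1 : (1 - (w x₀)⁻¹) ^ b ≤ 1 :=
    pow_le_one₀ (sub_nonneg.2 (inv_le_one_of_one_le₀ hW)) (sub_le_self _ (inv_nonneg.2 (hw0 x₀).le))
  have hw1 : wmin ≤ 1 := wmin_le_one (q := q) hge
  have hinv1 : 1 ≤ wmin⁻¹ := one_le_inv_iff₀.2 ⟨hwmin, hw1⟩
  -- `(1 + (1/wmin − 1) r^b) ≤ 1/wmin` and `(2W − 1) V / N ≤ wmin ε²`
  have hfac : 1 + (wmin⁻¹ - 1) * (1 - (w x₀)⁻¹) ^ b ≤ wmin⁻¹ := by nlinarith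
  have hV0 : 0 ≤ V := integral_nonneg fun x => sq_nonneg _
  have hX : 0 ≤ (2 * w x₀ - 1) * V / N := div_nonneg (mul_nonneg (by linarith) hV0) hNpos.le
  have hX2 : (2 * w x₀ - 1) * V / N ≤ wmin * ε ^ 2 := by rw [div_le_iff₀ hNpos]; exact hNε
  calc _ ≤ (1 + (wmin⁻¹ - 1) * (1 - (w x₀)⁻¹) ^ b) * ((2 * w x₀ - 1) * V / N) := h1
    _ ≤ wmin⁻¹ * (wmin * ε ^ 2) := mul_le_mul hfac hX2 hX (le_trans zero_le_one hinv1)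
    _ = ε ^ 2 := by rw [← mul_assoc, inv_mul_cancel₀ hwmin.ne', one_mul]

end Summit.Ventures.LatticeQCDFlow.Exactness
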